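import Mathlib
import HarnessLib
import Summits.AtomisticToContinuum.FouriersLaw.Theses.OddSectorIrreversibility
import Summits.AtomisticToContinuum.FouriersLaw.Theorems.OddResponseBound.Negative.OddPairing
import Literature.MathematicalPhysics.KineticTheory.LangevinChainKernel
import Literature.MathematicalPhysics.KineticTheory.OddSectorLocalityHypothesis

/-!
# Glue of crux idea `inner-cone-minkowski-tail` for `ConeScaleCorrector` (E1) — PROVED (fixed-N bookkeeping)

`InnerConeGlue : ∀ a > 0, ConeTransportBudget → PostCrossingMinkowskiTail a → ForecastBookkeeping a →
ConeScaleCorrector` — the two N-uniform stubs of the line plus fixed-N bookkeeping imply the route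
decl `Summit.AtomisticToContinuum.FouriersLaw.Theses.OddSectorIrreversibility.ConeScaleCorrector`
BY NAME. Proof: for `S ≤ aN` the Einstein–Helfand budget; for `S ≥ aN` the split
`u_S = u_{aN} + (u_S − u_{aN})`, Minkowski in `L²(μ_T)` and the Minkowski-in-time tail
`‖u_S − u_{aN}‖ ≤ ∫_{(aN,S]} ‖P_tJ‖ ≤ ∫_{aN}^∞ ‖P_tJ‖ ≤ C₂ N √Z`; hence `∫ u_S² ≤ K N² Z` for every
horizon; then Fatou along the crux's a.e.-limit predicate (the ONLY use of the predicate, cf.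
Disproof §2a) gives `MemLp u 2 μ_T` and `∫ u² ≤ K N² Z`, `K = (√(C₁⁺(1+a)) + C₂⁺)²`.
Definitions are those of `Sketch.lean` of the card (ideator 1, gen 2), verbatim.
-/

namespace Summit.AtomisticToContinuum.FouriersLaw.Cruxes.ConeScaleCorrector.IdeatorOneInnerCone

open MeasureTheory Filter Set Topology
open scoped BigOperators ENNReal NNReal

open Literature.MathematicalPhysics.KineticTheory.HeatConduction
open Literature.MathematicalPhysics.KineticTheory
open Summit.AtomisticToContinuum.FouriersLaw.Theorems.OddResponseBound.Negative.OddPairing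

noncomputable section

/-! ## Definitions (verbatim `Sketch.lean`) -/

/-- Unnormalised Gibbs weight `e^{−H_N/T} dq dp` of the crux. -/
def gibbsW (P : OscillatorChain) (N : ℕ) (T : ℝ) : Measure (PhaseSpace N) :=
  volume.withDensity (fun x : PhaseSpace N => ENNReal.ofReal (Real.exp (-(P.hamiltonian N x) / T)))

/-- Its mass `Z`. -/
def gibbsZ (P : OscillatorChain) (N : ℕ) (T : ℝ) : ℝ :=
  ∫ x, Real.exp (-(P.hamiltonian N x) / T) ∂(volume : Measure (PhaseSpace N))

/-- Total current `J = Σ_i j_i`. -/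
def Jtot (P : OscillatorChain) (N : ℕ) (z : PhaseSpace N) : ℝ := ∑ i : Fin N, P.bondCurrent N i z

/-- Forecast `(P_t f)(x)`. -/
def fcast (P : OscillatorChain) (N : ℕ) (T : ℝ) (f : PhaseSpace N → ℝ) (t : ℝ) (x : PhaseSpace N) : ℝ :=
  ∫ y, f y ∂(P.transitionKernel N T T t.toNNReal x)

/-- Finite-horizon Kubo forecast `u^f_S(x) = ∫₀^S (P_t f)(x) dt`. -/
def forecast (P : OscillatorChain) (N : ℕ) (T : ℝ) (f : PhaseSpace N → ℝ) (S : ℝ)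
    (x : PhaseSpace N) : ℝ :=
  ∫ t in Set.Ioc (0 : ℝ) S, fcast P N T f t x

/-- C1 · ConeTransportBudget. -/
def ConeTransportBudget : Prop :=
  ∀ ω₂ lam β γ : ℝ, 0 < ω₂ → 0 < lam → 0 < β → 0 < γ → ∀ T : ℝ, 0 < T → ∃ C : ℝ, ∀ N : ℕ, ∀ τ : ℝ,
    0 ≤ τ →
      let P := pinnedChain ω₂ lam β γ
      ∫ x, (forecast P N T (Jtot P N) τ x) ^ 2 ∂(gibbsW P N T) ≤ C * (N : ℝ) * (1 + τ) * gibbsZ P N T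

/-- FD2 · PostCrossingMinkowskiTail (first lemma of the card). -/
def PostCrossingMinkowskiTail (a : ℝ) : Prop :=
  ∀ ω₂ lam β γ : ℝ, 0 < ω₂ → 0 < lam → 0 < β → 0 < γ → ∀ T : ℝ, 0 < T → ∃ C : ℝ, ∀ N : ℕ,
    IntegrableOn (fun t : ℝ => Real.sqrt (OddSectorLocality.forecastNormSq ω₂ lam β γ T N t))
        (Set.Ioi (a * (N : ℝ))) ∧
      ∫ t in Set.Ioi (a * (N : ℝ)), Real.sqrt (OddSectorLocality.forecastNormSq ω₂ lam β γ T N t) ≤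
        C * (N : ℝ) * Real.sqrt (gibbsZ (pinnedChain ω₂ lam β γ) N T)

/-- Fixed-N bookkeeping. -/
def ForecastBookkeeping (a : ℝ) : Prop :=
  ∀ ω₂ lam β γ : ℝ, 0 < ω₂ → 0 < lam → 0 < β → 0 < γ → ∀ T : ℝ, 0 < T → ∀ N : ℕ, ∀ S : ℝ, 0 ≤ S →
    let P := pinnedChain ω₂ lam β γ
    MemLp (forecast P N T (Jtot P N) S) 2 (gibbsW P N T) ∧
      (a * (N : ℝ) ≤ S →
        IntegrableOn (fun t : ℝ => Real.sqrt (OddSectorLocality.forecastNormSq ω₂ lam β γ T N t))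
            (Set.Ioc (a * (N : ℝ)) S) →
          Real.sqrt (∫ x, (forecast P N T (Jtot P N) S x - forecast P N T (Jtot P N) (a * N) x) ^ 2
              ∂(gibbsW P N T)) ≤
            ∫ t in Set.Ioc (a * (N : ℝ)) S,
              Real.sqrt (OddSectorLocality.forecastNormSq ω₂ lam β γ T N t))

/-- Glue shape. -/
def InnerConeGlue : Prop :=
  ∀ a : ℝ, 0 < a → ConeTransportBudget → PostCrossingMinkowskiTail a → ForecastBookkeeping a →
    Summit.AtomisticToContinuum.FouriersLaw.Theses.OddSectorIrreversibility.ConeScaleCorrector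

/-! ## The crux through this file's vocabulary (`Iff.rfl` probe) -/

/-- The crux's corrector predicate. -/
def IsCorrectorLimit (P : OscillatorChain) (N : ℕ) (T : ℝ) (u : PhaseSpace N → ℝ) : Prop :=
  ∀ᵐ x ∂(gibbsW P N T), Tendsto (fun τ : ℝ => forecast P N T (Jtot P N) τ x) atTop (𝓝 (u x))

/-- E1 written with `gibbsW / gibbsZ / forecast / Jtot`. -/
def CruxClean : Prop :=
  ∀ ω₂ lam β γ : ℝ, 0 < ω₂ → 0 < lam → 0 < β → 0 < γ → ∀ T : ℝ, 0 < T → ∃ C : ℝ,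
    ∀ (N : ℕ) (u : PhaseSpace N → ℝ), IsCorrectorLimit (pinnedChain ω₂ lam β γ) N T u →
      MemLp u 2 (gibbsW (pinnedChain ω₂ lam β γ) N T) ∧
        ∫ x, (u x) ^ 2 ∂(gibbsW (pinnedChain ω₂ lam β γ) N T) ≤
          C * (N : ℝ) ^ 2 * gibbsZ (pinnedChain ω₂ lam β γ) N T

/-- PROBE: the route decl is, verbatim up to the abbreviations above, `CruxClean`. -/
theorem coneScaleCorrector_iff_clean :
    Summit.AtomisticToContinuum.FouriersLaw.Theses.OddSectorIrreversibility.ConeScaleCorrector ↔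
      CruxClean :=
  Iff.rfl

/-! ## Minkowski in `L²` for real functions (plain integrals) -/

theorem sqrt_integral_add_sq_le {X : Type*} [MeasurableSpace X] {μ : Measure X} {f g : X → ℝ}
    (hf : MemLp f 2 μ) (hg : MemLp g 2 μ) :
    Real.sqrt (∫ x, (f x + g x) ^ 2 ∂μ) ≤
      Real.sqrt (∫ x, f x ^ 2 ∂μ) + Real.sqrt (∫ x, g x ^ 2 ∂μ) := by
  set A := ∫ x, f x ^ 2 ∂μ with hA_def
  set B := ∫ x, g x ^ 2 ∂μ with hB_def
  have hA : 0 ≤ A := integral_nonneg fun _ => sq_nonneg _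
  have hB : 0 ≤ B := integral_nonneg fun _ => sq_nonneg _
  have hCS : (∫ x, f x * g x ∂μ) ^ 2 ≤ A * B := sq_integral_mul_le hf hg
  have hfg : ∫ x, f x * g x ∂μ ≤ Real.sqrt A * Real.sqrt B := by
    have h1 : |∫ x, f x * g x ∂μ| ≤ Real.sqrt (A * B) := by
      rw [← Real.sqrt_sq_eq_abs]
      exact Real.sqrt_le_sqrt hCS
    rw [Real.sqrt_mul hA] at h1
    exact le_trans (le_abs_self _) h1
  have hf2 : Integrable (fun x => f x ^ 2) μ := hf.integrable_sq
  have hg2 : Integrable (fun x => g x ^ 2) μ := hg.integrable_sq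
  have hfg' : Integrable (fun x => f x * g x) μ := hf.integrable_mul hg
  have h2fg : Integrable (fun x => 2 * (f x * g x)) μ := hfg'.const_mul 2
  have h12 : Integrable (fun x => f x ^ 2 + 2 * (f x * g x)) μ := hf2.add h2fg
  have hsum : ∫ x, (f x + g x) ^ 2 ∂μ = A + 2 * ∫ x, f x * g x ∂μ + B := by
    have e1 : ∫ x, (f x + g x) ^ 2 ∂μ = ∫ x, (f x ^ 2 + 2 * (f x * g x)) + g x ^ 2 ∂μ := by
      congr 1; funext x; ring
    have e2 : ∫ x, (f x ^ 2 + 2 * (f x * g x)) + g x ^ 2 ∂μ =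
        (∫ x, f x ^ 2 + 2 * (f x * g x) ∂μ) + ∫ x, g x ^ 2 ∂μ := integral_add h12 hg2
    have e3 : ∫ x, f x ^ 2 + 2 * (f x * g x) ∂μ = (∫ x, f x ^ 2 ∂μ) + ∫ x, 2 * (f x * g x) ∂μ :=
      integral_add hf2 h2fg
    have e4 : ∫ x, 2 * (f x * g x) ∂μ = 2 * ∫ x, f x * g x ∂μ := integral_const_mul 2 _
    rw [e1, e2, e3, e4]
  have hle : ∫ x, (f x + g x) ^ 2 ∂μ ≤ (Real.sqrt A + Real.sqrt B) ^ 2 := by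
    rw [hsum, add_sq, Real.sq_sqrt hA, Real.sq_sqrt hB]
    nlinarith [hfg]
  calc Real.sqrt (∫ x, (f x + g x) ^ 2 ∂μ)
      ≤ Real.sqrt ((Real.sqrt A + Real.sqrt B) ^ 2) := Real.sqrt_le_sqrt hle
    _ = Real.sqrt A + Real.sqrt B :=
        Real.sqrt_sq (add_nonneg (Real.sqrt_nonneg _) (Real.sqrt_nonneg _))

/-! ## The glue, proved -/

/-- **InnerConeGlue holds** (fixed-N bookkeeping only: the N-uniform content sits in the two stubs). -/
theorem innerConeGlue_holds : InnerConeGlue := by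
  intro a ha hB hT hK
  rw [coneScaleCorrector_iff_clean]
  intro ω₂ lam β γ hω hl hβ hγ T hTpos
  obtain ⟨C₁, hC₁⟩ := hB ω₂ lam β γ hω hl hβ hγ T hTpos
  obtain ⟨C₂, hC₂⟩ := hT ω₂ lam β γ hω hl hβ hγ T hTpos
  have hKK := hK ω₂ lam β γ hω hl hβ hγ T hTpos
  -- constants
  have hC₁' : C₁ ≤ max C₁ 0 := le_max_left _ _
  have hC₁'0 : 0 ≤ max C₁ 0 := le_max_right _ _
  have hC₂' : C₂ ≤ max C₂ 0 := le_max_left _ _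
  have hC₂'0 : 0 ≤ max C₂ 0 := le_max_right _ _
  have hD0 : 0 ≤ max C₁ 0 * (1 + a) := mul_nonneg hC₁'0 (by linarith)
  refine ⟨(Real.sqrt (max C₁ 0 * (1 + a)) + max C₂ 0) ^ 2, fun N u hu => ?_⟩
  have hKnonneg : 0 ≤ (Real.sqrt (max C₁ 0 * (1 + a)) + max C₂ 0) ^ 2 := sq_nonneg _
  have hDK : max C₁ 0 * (1 + a) ≤ (Real.sqrt (max C₁ 0 * (1 + a)) + max C₂ 0) ^ 2 := by
    have h1 : Real.sqrt (max C₁ 0 * (1 + a)) ^ 2 = max C₁ 0 * (1 + a) := Real.sq_sqrt hD0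
    nlinarith [Real.sqrt_nonneg (max C₁ 0 * (1 + a)), h1]
  -- abbreviations (no `set`, to keep defeq transparent)
  have hZ0 : 0 ≤ gibbsZ (pinnedChain ω₂ lam β γ) N T := integral_nonneg fun _ => (Real.exp_pos _).le
  have hN0 : (0 : ℝ) ≤ N := Nat.cast_nonneg N
  have hNN : (N : ℝ) ≤ (N : ℝ) ^ 2 := by
    have : (N : ℝ) * 1 ≤ (N : ℝ) * N := by
      rcases Nat.eq_zero_or_pos N with h0 | hpos
      · simp [h0]
      · exact mul_le_mul_of_nonneg_left (by exact_mod_cast hpos) hN0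
    nlinarith [this]
  -- MemLp of the explicit forecasts (bookkeeping)
  have hmem : ∀ S : ℝ, 0 ≤ S →
      MemLp (forecast (pinnedChain ω₂ lam β γ) N T (Jtot (pinnedChain ω₂ lam β γ) N) S) 2
        (gibbsW (pinnedChain ω₂ lam β γ) N T) := fun S hS => (hKK N S hS).1
  -- budget up to the crossing, in the form  ∫ u_S² ≤ (max C₁ 0)(1+a) N² Z
  have hbudget : ∀ S : ℝ, 0 ≤ S → S ≤ a * N →
      ∫ x, (forecast (pinnedChain ω₂ lam β γ) N T (Jtot (pinnedChain ω₂ lam β γ) N) S x) ^ 2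
          ∂(gibbsW (pinnedChain ω₂ lam β γ) N T) ≤
        max C₁ 0 * (1 + a) * (N : ℝ) ^ 2 * gibbsZ (pinnedChain ω₂ lam β γ) N T := by
    intro S hS hSa
    have h1 : ∫ x, (forecast (pinnedChain ω₂ lam β γ) N T (Jtot (pinnedChain ω₂ lam β γ) N) S x) ^ 2
          ∂(gibbsW (pinnedChain ω₂ lam β γ) N T) ≤
        C₁ * (N : ℝ) * (1 + S) * gibbsZ (pinnedChain ω₂ lam β γ) N T := hC₁ N S hS
    have h2 : C₁ * (N : ℝ) * (1 + S) * gibbsZ (pinnedChain ω₂ lam β γ) N T ≤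
        max C₁ 0 * (N : ℝ) * (1 + S) * gibbsZ (pinnedChain ω₂ lam β γ) N T := by
      have : 0 ≤ (N : ℝ) * (1 + S) * gibbsZ (pinnedChain ω₂ lam β γ) N T := by positivity
      nlinarith [hC₁', this]
    have h3 : max C₁ 0 * (N : ℝ) * (1 + S) * gibbsZ (pinnedChain ω₂ lam β γ) N T ≤
        max C₁ 0 * (1 + a) * (N : ℝ) ^ 2 * gibbsZ (pinnedChain ω₂ lam β γ) N T := by
      have h4 : (N : ℝ) * (1 + S) ≤ (1 + a) * (N : ℝ) ^ 2 := by
        have h5 : (N : ℝ) * S ≤ (N : ℝ) * (a * N) := mul_le_mul_of_nonneg_left hSa hN0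
        nlinarith [h5, hNN, ha, hN0]
      have := mul_le_mul_of_nonneg_left h4 hC₁'0
      have := mul_le_mul_of_nonneg_right this hZ0
      nlinarith [this]
    linarith
  -- uniform bound on every horizon
  have hunif : ∀ S : ℝ, 0 ≤ S →
      ∫ x, (forecast (pinnedChain ω₂ lam β γ) N T (Jtot (pinnedChain ω₂ lam β γ) N) S x) ^ 2
          ∂(gibbsW (pinnedChain ω₂ lam β γ) N T) ≤
        (Real.sqrt (max C₁ 0 * (1 + a)) + max C₂ 0) ^ 2 * (N : ℝ) ^ 2 *
          gibbsZ (pinnedChain ω₂ lam β γ) N T := by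
    intro S hS
    rcases le_or_gt S (a * N) with hSa | hSa
    · have := hbudget S hS hSa
      have h' : max C₁ 0 * (1 + a) * (N : ℝ) ^ 2 * gibbsZ (pinnedChain ω₂ lam β γ) N T ≤
          (Real.sqrt (max C₁ 0 * (1 + a)) + max C₂ 0) ^ 2 * (N : ℝ) ^ 2 *
            gibbsZ (pinnedChain ω₂ lam β γ) N T := by
        have : 0 ≤ (N : ℝ) ^ 2 * gibbsZ (pinnedChain ω₂ lam β γ) N T := by positivity
        nlinarith [hDK, this]
      linarith
    · -- S beyond the crossing: split u_S = u_{aN} + (u_S − u_{aN})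
      have haN0 : 0 ≤ a * N := mul_nonneg ha.le hN0
      have haNS : a * N ≤ S := hSa.le
      set f := forecast (pinnedChain ω₂ lam β γ) N T (Jtot (pinnedChain ω₂ lam β γ) N) (a * N)
        with hf_def
      set uS := forecast (pinnedChain ω₂ lam β γ) N T (Jtot (pinnedChain ω₂ lam β γ) N) S
        with huS_def
      set g : PhaseSpace N → ℝ := fun x => uS x - f x with hg_def
      have hfm : MemLp f 2 (gibbsW (pinnedChain ω₂ lam β γ) N T) := hmem (a * N) haN0
      have huSm : MemLp uS 2 (gibbsW (pinnedChain ω₂ lam β γ) N T) := hmem S hS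
      have hgm : MemLp g 2 (gibbsW (pinnedChain ω₂ lam β γ) N T) := huSm.sub hfm
      have hsplit : (fun x => uS x) = fun x => f x + g x := by
        funext x; simp [hg_def]
      -- ‖f‖ ≤ √(D) N √Z
      have hf_le : Real.sqrt (∫ x, f x ^ 2 ∂(gibbsW (pinnedChain ω₂ lam β γ) N T)) ≤
          Real.sqrt (max C₁ 0 * (1 + a)) * N * Real.sqrt (gibbsZ (pinnedChain ω₂ lam β γ) N T) := by
        have h1 := hbudget (a * N) haN0 le_rfl
        have h2 : Real.sqrt (∫ x, f x ^ 2 ∂(gibbsW (pinnedChain ω₂ lam β γ) N T)) ≤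
            Real.sqrt (max C₁ 0 * (1 + a) * (N : ℝ) ^ 2 * gibbsZ (pinnedChain ω₂ lam β γ) N T) :=
          Real.sqrt_le_sqrt h1
        have h3 : Real.sqrt (max C₁ 0 * (1 + a) * (N : ℝ) ^ 2 * gibbsZ (pinnedChain ω₂ lam β γ) N T) =
            Real.sqrt (max C₁ 0 * (1 + a)) * N * Real.sqrt (gibbsZ (pinnedChain ω₂ lam β γ) N T) := by
          rw [Real.sqrt_mul (by positivity), Real.sqrt_mul hD0, Real.sqrt_sq hN0]
        linarith [h2, h3.le, h3.ge]
      -- ‖g‖ ≤ ∫_{(aN,S]} √A ≤ ∫_{(aN,∞)} √A ≤ C₂ N √Z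
      have hIoi := (hC₂ N).1
      have hIoc : IntegrableOn
          (fun t : ℝ => Real.sqrt (OddSectorLocality.forecastNormSq ω₂ lam β γ T N t))
          (Set.Ioc (a * (N : ℝ)) S) := hIoi.mono_set Set.Ioc_subset_Ioi_self
      have hg_le1 : Real.sqrt (∫ x, g x ^ 2 ∂(gibbsW (pinnedChain ω₂ lam β γ) N T)) ≤
          ∫ t in Set.Ioc (a * (N : ℝ)) S,
            Real.sqrt (OddSectorLocality.forecastNormSq ω₂ lam β γ T N t) :=
        (hKK N S hS).2 haNS hIoc
      have hg_le2 : ∫ t in Set.Ioc (a * (N : ℝ)) S,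
            Real.sqrt (OddSectorLocality.forecastNormSq ω₂ lam β γ T N t) ≤
          ∫ t in Set.Ioi (a * (N : ℝ)),
            Real.sqrt (OddSectorLocality.forecastNormSq ω₂ lam β γ T N t) :=
        setIntegral_mono_set hIoi (ae_of_all _ fun t => Real.sqrt_nonneg _)
          (ae_of_all _ Set.Ioc_subset_Ioi_self)
      have hg_le3 : ∫ t in Set.Ioi (a * (N : ℝ)),
            Real.sqrt (OddSectorLocality.forecastNormSq ω₂ lam β γ T N t) ≤
          max C₂ 0 * N * Real.sqrt (gibbsZ (pinnedChain ω₂ lam β γ) N T) := by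
        have h1 := (hC₂ N).2
        have : 0 ≤ (N : ℝ) * Real.sqrt (gibbsZ (pinnedChain ω₂ lam β γ) N T) := by positivity
        nlinarith [h1, hC₂', this]
      have hg_le : Real.sqrt (∫ x, g x ^ 2 ∂(gibbsW (pinnedChain ω₂ lam β γ) N T)) ≤
          max C₂ 0 * N * Real.sqrt (gibbsZ (pinnedChain ω₂ lam β γ) N T) :=
        hg_le1.trans (hg_le2.trans hg_le3)
      -- Minkowski
      have hmink : Real.sqrt (∫ x, uS x ^ 2 ∂(gibbsW (pinnedChain ω₂ lam β γ) N T)) ≤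
          (Real.sqrt (max C₁ 0 * (1 + a)) + max C₂ 0) * N *
            Real.sqrt (gibbsZ (pinnedChain ω₂ lam β γ) N T) := by
        have h1 : Real.sqrt (∫ x, uS x ^ 2 ∂(gibbsW (pinnedChain ω₂ lam β γ) N T)) =
            Real.sqrt (∫ x, (f x + g x) ^ 2 ∂(gibbsW (pinnedChain ω₂ lam β γ) N T)) := by
          congr 1
          refine integral_congr_ae (ae_of_all _ fun x => ?_)
          simp only [hg_def]
          ring
        rw [h1]
        have h2 := sqrt_integral_add_sq_le hfm hgm
        nlinarith [h2, hf_le, hg_le]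
      -- square
      have hsq : ∫ x, uS x ^ 2 ∂(gibbsW (pinnedChain ω₂ lam β γ) N T) =
          Real.sqrt (∫ x, uS x ^ 2 ∂(gibbsW (pinnedChain ω₂ lam β γ) N T)) ^ 2 :=
        (Real.sq_sqrt (integral_nonneg fun _ => sq_nonneg _)).symm
      have hR0 : 0 ≤ (Real.sqrt (max C₁ 0 * (1 + a)) + max C₂ 0) * N *
          Real.sqrt (gibbsZ (pinnedChain ω₂ lam β γ) N T) := by positivity
      have hL0 : 0 ≤ Real.sqrt (∫ x, uS x ^ 2 ∂(gibbsW (pinnedChain ω₂ lam β γ) N T)) :=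
        Real.sqrt_nonneg _
      have h3 : Real.sqrt (∫ x, uS x ^ 2 ∂(gibbsW (pinnedChain ω₂ lam β γ) N T)) ^ 2 ≤
          ((Real.sqrt (max C₁ 0 * (1 + a)) + max C₂ 0) * N *
            Real.sqrt (gibbsZ (pinnedChain ω₂ lam β γ) N T)) ^ 2 :=
        pow_le_pow_left₀ hL0 hmink 2
      have h4 : ((Real.sqrt (max C₁ 0 * (1 + a)) + max C₂ 0) * N *
            Real.sqrt (gibbsZ (pinnedChain ω₂ lam β γ) N T)) ^ 2 =
          (Real.sqrt (max C₁ 0 * (1 + a)) + max C₂ 0) ^ 2 * (N : ℝ) ^ 2 *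
            gibbsZ (pinnedChain ω₂ lam β γ) N T := by
        rw [mul_pow, mul_pow, Real.sq_sqrt hZ0]
      rw [hsq]
      linarith [h3, h4.le]
  -- FATOU along the a.e. limit (through the sequence of integer horizons)
  set μ := gibbsW (pinnedChain ω₂ lam β γ) N T with hμ_def
  set K := (Real.sqrt (max C₁ 0 * (1 + a)) + max C₂ 0) ^ 2 with hK_def
  set Z := gibbsZ (pinnedChain ω₂ lam β γ) N T with hZ_def
  let v : ℕ → PhaseSpace N → ℝ := fun n x =>
    forecast (pinnedChain ω₂ lam β γ) N T (Jtot (pinnedChain ω₂ lam β γ) N) (n : ℝ) x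
  have hv_mem : ∀ n, MemLp (v n) 2 μ := fun n => hmem (n : ℝ) (Nat.cast_nonneg n)
  have hv_tend : ∀ᵐ x ∂μ, Tendsto (fun n : ℕ => v n x) atTop (𝓝 (u x)) :=
    hu.mono fun x hx => hx.comp tendsto_natCast_atTop_atTop
  have hu_meas : AEStronglyMeasurable u μ :=
    aestronglyMeasurable_of_tendsto_ae atTop (fun n => (hv_mem n).1) hv_tend
  have hlim : ∀ᵐ x ∂μ, Tendsto (fun n : ℕ => ENNReal.ofReal ((v n x) ^ 2)) atTop
      (𝓝 (ENNReal.ofReal ((u x) ^ 2))) := by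
    filter_upwards [hv_tend] with x hx
    exact (ENNReal.continuous_ofReal.tendsto _).comp ((hx.pow 2))
  have hliminf_eq : (fun x => ENNReal.ofReal ((u x) ^ 2)) =ᵐ[μ]
      fun x => liminf (fun n : ℕ => ENNReal.ofReal ((v n x) ^ 2)) atTop := by
    filter_upwards [hlim] with x hx
    exact hx.liminf_eq.symm
  have hterm : ∀ n : ℕ, ∫⁻ x, ENNReal.ofReal ((v n x) ^ 2) ∂μ ≤ ENNReal.ofReal (K * (N : ℝ) ^ 2 * Z) := by
    intro n
    have hint : Integrable (fun x => (v n x) ^ 2) μ := (hv_mem n).integrable_sq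
    rw [← ofReal_integral_eq_lintegral_ofReal hint (ae_of_all _ fun x => sq_nonneg _)]
    exact ENNReal.ofReal_le_ofReal (hunif (n : ℝ) (Nat.cast_nonneg n))
  have hlint : ∫⁻ x, ENNReal.ofReal ((u x) ^ 2) ∂μ ≤ ENNReal.ofReal (K * (N : ℝ) ^ 2 * Z) := by
    rw [lintegral_congr_ae hliminf_eq]
    have hmeas : ∀ n : ℕ, AEMeasurable (fun x => ENNReal.ofReal ((v n x) ^ 2)) μ := fun n =>
      ENNReal.measurable_ofReal.comp_aemeasurable (((hv_mem n).1.aemeasurable).pow_const 2)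
    refine (lintegral_liminf_le' hmeas).trans ?_
    refine (liminf_le_limsup).trans ?_
    exact limsup_le_of_le (by isBoundedDefault) (Eventually.of_forall hterm)
  have hu_sq_int : Integrable (fun x => (u x) ^ 2) μ := by
    refine ⟨(hu_meas.aemeasurable.pow_const 2).aestronglyMeasurable, ?_⟩
    rw [hasFiniteIntegral_iff_ofReal (ae_of_all _ fun x => sq_nonneg _)]
    exact lt_of_le_of_lt hlint ENNReal.ofReal_lt_top
  have hu_memLp : MemLp u 2 μ := (memLp_two_iff_integrable_sq hu_meas).2 hu_sq_int
  refine ⟨hu_memLp, ?_⟩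
  have hKZ : 0 ≤ K * (N : ℝ) ^ 2 * Z := by positivity
  rw [integral_eq_lintegral_of_nonneg_ae (ae_of_all _ fun x => sq_nonneg _)
    hu_sq_int.aestronglyMeasurable]
  have := ENNReal.toReal_mono ENNReal.ofReal_ne_top hlint
  rwa [ENNReal.toReal_ofReal hKZ] at this

end

end Summit.AtomisticToContinuum.FouriersLaw.Cruxes.ConeScaleCorrector.IdeatorOneInnerCone
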